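import Summits.BirchSwinnertonDyer.BirchSwinnertonDyer.Theorems.SignedBaseChangeK2RSqueeze
import HarnessLib

/-!
# `SignedBaseChange.KobayashiSqueeze` holds (route SignedBaseChange, glue item, gen 4)

The squeeze from the Eisenstein half `KobayashiLowerDivisibility` to `KobayashiMainConjecture` under `Surj`,
Kobayashi Thm 1.2 / 4.1 and the period unit `ord_p ϖ = 0` is PROVED in the tree by bsd-wall-sbc-p2
(`Theorems.SignedBaseChangeK2RSqueeze.kobayashiMainConjecture_of_lowerDivisibility_of_periodUnit`, p512698);
this file restates nothing and closes the glue item by name.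
-/

set_option autoImplicit false

namespace Summit.BirchSwinnertonDyer.BirchSwinnertonDyer.Theorems.SignedBaseChangeSqueezeGlue

/-- The glue item `KobayashiSqueeze` of route SignedBaseChange holds. -/
theorem kobayashiSqueeze_holds :
    Summit.BirchSwinnertonDyer.BirchSwinnertonDyer.Theses.SignedBaseChange.KobayashiSqueeze :=
  fun h12 h41 W _ _ p _ hp hgood hap hs hunit ε hlow =>
    Summit.BirchSwinnertonDyer.BirchSwinnertonDyer.Theorems.SignedBaseChangeK2RSqueeze.kobayashiMainConjecture_of_lowerDivisibility_of_periodUnit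
      h12 h41 W p hp hgood hap hs hunit ε hlow

end Summit.BirchSwinnertonDyer.BirchSwinnertonDyer.Theorems.SignedBaseChangeSqueezeGlue
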